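import Summits.ValiantsHypothesis.ValiantsHypothesis.Theorems.MatrixDescartes.Negative.MatrixDescartesFalseOfTropicalMonster

/-!
# DoorMCL — the Monotone Cycle Law stated and proved for the tropical door's own data
(`IsDominant`, `tropWeight`, `termSign` of `MatrixDescartesFalseOfTropicalMonster`, p164927):
any two dominant terms `p₁` at `θ₁ < θ₂` at `p₂` of ONE design are cycle-monotone — on every common invariant
row set `U` the exponent mass carried by `p₂` is at least that carried by `p₁`.  val-idea-23 (d).
-/

open Finset BigOperators

namespace Summit.ValiantsHypothesis.ValiantsHypothesis.Cruxes.MatrixDescartes.CycleMonotone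

open Summit.ValiantsHypothesis.ValiantsHypothesis.Theorems.MatrixDescartes.Negative

theorem exists_switch' {N : ℕ} (σ₁ σ₂ : Equiv.Perm (Fin N)) (U : Finset (Fin N))
    (hU : U.image σ₁ = U.image σ₂) :
    ∃ σ₃ : Equiv.Perm (Fin N), (∀ i ∈ U, σ₃ i = σ₂ i) ∧ (∀ i ∉ U, σ₃ i = σ₁ i) := by
  classical
  let g : Fin N → Fin N := fun i => if i ∈ U then σ₂ i else σ₁ i
  have ginj : Function.Injective g := by
    intro i j hij
    change (if i ∈ U then σ₂ i else σ₁ i) = (if j ∈ U then σ₂ j else σ₁ j) at hij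
    by_cases hi : i ∈ U <;> by_cases hj : j ∈ U
    · rw [if_pos hi, if_pos hj] at hij; exact σ₂.injective hij
    · rw [if_pos hi, if_neg hj] at hij
      exfalso
      have hmem : σ₂ i ∈ U.image σ₂ := Finset.mem_image_of_mem _ hi
      rw [← hU, hij] at hmem
      obtain ⟨k, hk, hkj⟩ := Finset.mem_image.mp hmem
      exact hj (σ₁.injective hkj ▸ hk)
    · rw [if_neg hi, if_pos hj] at hij
      exfalso
      have hmem : σ₂ j ∈ U.image σ₂ := Finset.mem_image_of_mem _ hj
      rw [← hU, ← hij] at hmem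
      obtain ⟨k, hk, hki⟩ := Finset.mem_image.mp hmem
      exact hi (σ₁.injective hki ▸ hk)
    · rw [if_neg hi, if_neg hj] at hij; exact σ₁.injective hij
  refine ⟨Equiv.ofBijective g (Finite.injective_iff_bijective.mp ginj), ?_, ?_⟩
  · intro i hi; simp [g, hi]
  · intro i hi; simp [g, hi]

/-- **MCL at the door.** For ONE tropical design `(d, v, ε)`: if the term `p₁ = (σ₁, λ₁)` is dominant at `θ₁` and
`p₂ = (σ₂, λ₂)` is dominant at `θ₂ > θ₁`, then for every row set `U` with `σ₁ '' U = σ₂ '' U`,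
`∑_{i ∈ U} d (λ₁ i) ≤ ∑_{i ∈ U} d (λ₂ i)`.  In particular every pair `p j, p k` (`j < k`) of a `TropicalMonster`
witness is cycle-monotone. -/
theorem door_mcl {m K : ℕ} (d : Fin K → ℕ) (v ε : Fin m → Fin m → Fin K → ℤ) {θ₁ θ₂ : ℤ} (hθ : θ₁ < θ₂)
    {p₁ p₂ : Equiv.Perm (Fin m) × (Fin m → Fin K)}
    (h₁ : IsDominant d v ε θ₁ p₁) (h₂ : IsDominant d v ε θ₂ p₂)
    (U : Finset (Fin m)) (hU : U.image p₁.1 = U.image p₂.1) :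
    ∑ i ∈ U, (d (p₁.2 i) : ℤ) ≤ ∑ i ∈ U, (d (p₂.2 i) : ℤ) := by
  classical
  obtain ⟨σ₃, h3U, h3c⟩ := exists_switch' p₁.1 p₂.1 U hU
  obtain ⟨σ₄, h4U, h4c⟩ := exists_switch' p₂.1 p₁.1 U hU.symm
  let l₃ : Fin m → Fin K := fun i => if i ∈ U then p₂.2 i else p₁.2 i
  let l₄ : Fin m → Fin K := fun i => if i ∈ U then p₁.2 i else p₂.2 i
  let p₃ : Equiv.Perm (Fin m) × (Fin m → Fin K) := (σ₃, l₃)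
  let p₄ : Equiv.Perm (Fin m) × (Fin m → Fin K) := (σ₄, l₄)
  -- row-wise description of the switches
  have r3 : ∀ i, (p₃.1 i, p₃.2 i) = if i ∈ U then (p₂.1 i, p₂.2 i) else (p₁.1 i, p₁.2 i) := by
    intro i; by_cases hi : i ∈ U
    · simp [p₃, l₃, hi, h3U i hi]
    · simp [p₃, l₃, hi, h3c i hi]
  have r4 : ∀ i, (p₄.1 i, p₄.2 i) = if i ∈ U then (p₁.1 i, p₁.2 i) else (p₂.1 i, p₂.2 i) := by
    intro i; by_cases hi : i ∈ U
    · simp [p₄, l₄, hi, h4U i hi]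
    · simp [p₄, l₄, hi, h4c i hi]
  -- the exchange identity for any row functional G (column, row, class) ↦ ℤ
  have key : ∀ G : Fin m → Fin m → Fin K → ℤ,
      ∑ i, G (p₃.1 i) i (p₃.2 i) + ∑ i, G (p₄.1 i) i (p₄.2 i)
        = ∑ i, G (p₁.1 i) i (p₁.2 i) + ∑ i, G (p₂.1 i) i (p₂.2 i) := by
    intro G
    rw [← Finset.sum_add_distrib, ← Finset.sum_add_distrib]
    apply Finset.sum_congr rfl
    intro i _
    have e3 := r3 i
    have e4 := r4 i
    by_cases hi : i ∈ U
    · rw [if_pos hi] at e3 e4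
      rw [(Prod.mk.injEq _ _ _ _).mp e3 |>.1, (Prod.mk.injEq _ _ _ _).mp e3 |>.2,
          (Prod.mk.injEq _ _ _ _).mp e4 |>.1, (Prod.mk.injEq _ _ _ _).mp e4 |>.2, add_comm]
    · rw [if_neg hi] at e3 e4
      rw [(Prod.mk.injEq _ _ _ _).mp e3 |>.1, (Prod.mk.injEq _ _ _ _).mp e3 |>.2,
          (Prod.mk.injEq _ _ _ _).mp e4 |>.1, (Prod.mk.injEq _ _ _ _).mp e4 |>.2]
  -- S and V
  have kS := key (fun _ _ l => (d l : ℤ))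
  have kV := key v
  -- presence of the switched terms
  have fac1 : ∀ i, ε (p₁.1 i) i (p₁.2 i) ≠ 0 := by
    intro i
    have h := h₁.1
    unfold termSign at h
    exact Finset.prod_ne_zero_iff.mp (right_ne_zero_of_mul h) i (Finset.mem_univ i)
  have fac2 : ∀ i, ε (p₂.1 i) i (p₂.2 i) ≠ 0 := by
    intro i
    have h := h₂.1
    unfold termSign at h
    exact Finset.prod_ne_zero_iff.mp (right_ne_zero_of_mul h) i (Finset.mem_univ i)
  have pres3 : termSign ε p₃ ≠ 0 := by
    unfold termSign
    refine mul_ne_zero (Units.ne_zero _) (Finset.prod_ne_zero_iff.mpr ?_)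
    intro i _
    have e3 := r3 i
    by_cases hi : i ∈ U
    · rw [if_pos hi] at e3
      rw [(Prod.mk.injEq _ _ _ _).mp e3 |>.1, (Prod.mk.injEq _ _ _ _).mp e3 |>.2]; exact fac2 i
    · rw [if_neg hi] at e3
      rw [(Prod.mk.injEq _ _ _ _).mp e3 |>.1, (Prod.mk.injEq _ _ _ _).mp e3 |>.2]; exact fac1 i
  have pres4 : termSign ε p₄ ≠ 0 := by
    unfold termSign
    refine mul_ne_zero (Units.ne_zero _) (Finset.prod_ne_zero_iff.mpr ?_)
    intro i _
    have e4 := r4 i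
    by_cases hi : i ∈ U
    · rw [if_pos hi] at e4
      rw [(Prod.mk.injEq _ _ _ _).mp e4 |>.1, (Prod.mk.injEq _ _ _ _).mp e4 |>.2]; exact fac1 i
    · rw [if_neg hi] at e4
      rw [(Prod.mk.injEq _ _ _ _).mp e4 |>.1, (Prod.mk.injEq _ _ _ _).mp e4 |>.2]; exact fac2 i
  -- optimality inequalities (≤ form, covering the case p₃ = p₁)
  have e1 : tropWeight d v θ₁ p₃ ≤ tropWeight d v θ₁ p₁ := by
    by_cases hp : p₃ = p₁
    · rw [hp]
    · exact le_of_lt (h₁.2 p₃ hp pres3)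
  have e2 : tropWeight d v θ₂ p₄ ≤ tropWeight d v θ₂ p₂ := by
    by_cases hp : p₄ = p₂
    · rw [hp]
    · exact le_of_lt (h₂.2 p₄ hp pres4)
  unfold tropWeight at e1 e2
  -- S₃ - S₁ on U
  have hvan : ∀ x ∈ (Finset.univ : Finset (Fin m)), x ∉ U → ((d (p₃.2 x) : ℤ) - (d (p₁.2 x) : ℤ)) = 0 := by
    intro x _ hx
    have e3 := r3 x
    rw [if_neg hx] at e3
    rw [(Prod.mk.injEq _ _ _ _).mp e3 |>.2]; exact sub_self _
  have hs3 : ∑ i, (d (p₃.2 i) : ℤ) - ∑ i, (d (p₁.2 i) : ℤ) = ∑ i ∈ U, ((d (p₂.2 i) : ℤ) - (d (p₁.2 i) : ℤ)) := by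
    rw [← Finset.sum_sub_distrib, ← Finset.sum_subset (Finset.subset_univ U) hvan]
    refine Finset.sum_congr rfl (fun i hi => ?_)
    have e3 := r3 i
    rw [if_pos hi] at e3
    rw [(Prod.mk.injEq _ _ _ _).mp e3 |>.2]
  rw [Finset.sum_sub_distrib] at hs3
  -- arithmetic
  set S₁ := ∑ i, (d (p₁.2 i) : ℤ) with hS₁
  set S₂ := ∑ i, (d (p₂.2 i) : ℤ) with hS₂
  set S₃ := ∑ i, (d (p₃.2 i) : ℤ) with hS₃
  set S₄ := ∑ i, (d (p₄.2 i) : ℤ) with hS₄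
  set V₁ := ∑ i, v (p₁.1 i) i (p₁.2 i) with hV₁
  set V₂ := ∑ i, v (p₂.1 i) i (p₂.2 i) with hV₂
  set V₃ := ∑ i, v (p₃.1 i) i (p₃.2 i) with hV₃
  set V₄ := ∑ i, v (p₄.1 i) i (p₄.2 i) with hV₄
  have ks2 : θ₂ * S₃ + θ₂ * S₄ = θ₂ * S₁ + θ₂ * S₂ := by rw [← mul_add, ← mul_add, kS]
  have e3 : θ₂ * S₁ - V₁ ≤ θ₂ * S₃ - V₃ := by linarith [e2, kV, ks2]
  have hpos : 0 < θ₂ - θ₁ := sub_pos.mpr hθ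
  have e5 : 0 ≤ S₃ - S₁ := by
    by_contra hneg
    push_neg at hneg
    have hprod := mul_neg_of_pos_of_neg hpos hneg
    nlinarith [e1, e3, hprod]
  linarith [e5, hs3]

end Summit.ValiantsHypothesis.ValiantsHypothesis.Cruxes.MatrixDescartes.CycleMonotone
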